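import Summits.CriticalPhenomena.CardyFormulaZ2.Theorems.CardyComplexConeParafermionToSLESixFamiliesDiamondTraceFreeCore
import Summits.CriticalPhenomena.CardyFormulaZ2.Theorems.CardyComplexConeParafermionToSLESixFamiliesDiamondTraceWiredChain
import HarnessLib

/-!
# The wired-side core of the boundary trace: the chain-layer potential runs in the direction `u δ · τ` up to a
# bounded error (line `potential-darboux-picard-diamond`, S1‴ assembly, one wired side at one mesh)

Crux `ParafermionToSLESixFamilies` (stmt-CriticalPhenomena-11389), line `potential-darboux-picard-diamond`, stub
`stub_exactPotentialTracePh3` (S1‴). Companion of `…DiamondTraceFreeCore.lean` for a WIRED side: one admissible Jordan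
datum `E` (`E.Ω = D.carrier`) on the open tilted rectangle of a side frame, chart `(A, B) = (layerFn j, layerFn (j+1))`,
last inside layer `n`, a window `[Yl, Yr]` of ordinates in the bulk, and the two eventual hypotheses of the assembly on
it: (ARC) sites of layers `n−4 … n` are off the dual-wired arc and on the wired one when boundary sites
(`eventually_arcs_near_wiredSegment`), (PHASE) the passage phase at the first `A`-corner dart `(a, j)` of every tip cell
(`a, a + u_{j+1}, a + u_{j+2} ∈ A`) is `d · conj(iʲ e^{+iπ/6})` for ONE unit `d` (`BoundaryDartPhase`, `i = 0`).

* `tipRow_of_chart` — the tip site `a = x − u_j` of a chain site `x` (`A x = n − 2`) satisfies the ten lattice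
  hypotheses of `exactPair_wiredChainSum_of_phase` (the tip cell `faceAt a j = faceAt x (j+1)`);
* `wired_phase_of_chart` — the passage phase at `(a, j)` is the constant `d · conj(iʲ e^{iπ/6})`;
* `exp_pi_six_add_exp_neg` — `e^{iπ/6} + e^{-iπ/6} = √3`;
* `wired_chainSum_of_chart` (registered, `--supports` the crux) — **the chain-layer potential of a wired side runs in
  the direction `d`**: along `x_i = x − i(u_j + u_{j+1})`, `Ψ (faceAt x_N j) − Ψ (faceAt x_0 j) = R · d + ε` with
  `R = √3 · Σ_{m<N} P(passage of (a_m, j)) ≥ 0` and `‖ε‖ ≤ 5` (the wired chain sum `iʲ ζ (Σ P + e^{iπ/3} Σ P(·+1))`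
  re-summed as `d (√3 Σ P + e^{iπ/6}(P_N − P_0))`, plus the two links `‖Ψ (faceAt x j) − Ψ (faceAt x (j+1))‖ ≤ 2`
  through the interior corner `x`).
-/

noncomputable section

namespace Summit.CriticalPhenomena.CardyFormulaZ2.Cruxes.ParafermionToSLESixFamilies.PotentialDarbouxPicardDiamond

open scoped BigOperators
open Set Metric Complex MeasureTheory
open Literature.Probability Literature.Probability.LatticeModels Literature.Probability.Percolation
open Literature.Probability.LatticeModels.DiscreteDobrushin
open Literature.Probability.RandomPlanarGeometry
open Summit.CriticalPhenomena.CardyFormulaZ2.Cruxes.EdgePrecompact.QkzStripBoundaryArm (cornerObs)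
open Summit.CriticalPhenomena.CardyFormulaZ2.Cruxes.ParafermionToSLESixFamilies.IicTraceFluxPairing
  (touchSites touchProb)

/-- `e^{iπ/6} + e^{-iπ/6} = √3`. -/
theorem exp_pi_six_add_exp_neg :
    Complex.exp ((Real.pi / 6 : ℝ) * I) + Complex.exp (-(Real.pi / 6 : ℝ) * I) = (Real.sqrt 3 : ℂ) := by
  rw [← Complex.two_cos, ← Complex.ofReal_cos, Real.cos_pi_div_six]
  push_cast; ring

/-- A re-summation: `Σ_{m<N} f (m+1) = Σ_{m<N} f m + f N − f 0`. -/
theorem sum_range_shift (f : ℕ → ℂ) (N : ℕ) :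
    ∑ m ∈ Finset.range N, f (m + 1) = ∑ m ∈ Finset.range N, f m + f N - f 0 := by
  have h1 := Finset.sum_range_succ' f N
  have h2 := Finset.sum_range_succ f N
  linear_combination h2 - h1

section Core

variable {c e : ℂ} (he : ‖e‖ = 1) {α β δ : ℝ} (hδ : 0 < δ) (hα : 4 * δ ≤ α) {D : DobrushinDomain} {E : DiscreteDobrushin}
  (hΩ : E.Ω = {z : ℂ | |((z - c) * e).re| < α ∧ |((z - c) * e).im| < β}) (hΩD : E.Ω = D.carrier) (hEδ : E.δ = δ)
  (hE : E.IsZdAdmissible) (hgood : ∀ x : Site 2, meshPoint δ x ∈ E.Ω → x ∈ meshDomain E.Ω δ)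
  {j : Fin 4} {X₀ Y₀ : ℝ} (hX : ∀ x : Site 2, ((meshPoint δ x - c) * e).re = Real.sqrt 2 / 2 * δ * layerFn j x + X₀)
  (hY : ∀ x : Site 2, ((meshPoint δ x - c) * e).im = Real.sqrt 2 / 2 * δ * layerFn (j + 1) x + Y₀)
  {n : ℤ} (hn : Real.sqrt 2 / 2 * δ * n + X₀ < α) (hn' : α ≤ Real.sqrt 2 / 2 * δ * (n + 1) + X₀)
  {Yl Yr : ℝ} (hYl : -β + 3 * δ < Yl) (hYr : Yr + 3 * δ < β)
  (hArcW : ∀ x : Site 2, n - 4 ≤ layerFn j x → layerFn j x ≤ n → Yl ≤ ((meshPoint δ x - c) * e).im →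
    ((meshPoint δ x - c) * e).im ≤ Yr → x ∉ E.zdArcB ∧ (x ∈ E.zdBoundary → x ∈ E.zdArcA))
  {d : ℂ} (hd : ‖d‖ = 1)
  (hPhW : ∀ a : Site 2, layerFn j a = n - 1 → Yl ≤ ((meshPoint δ a - c) * e).im → ((meshPoint δ a - c) * e).im ≤ Yr →
    E.IsInnerFace (faceAt a j) → a ∈ E.zdArcA → a + cornerUnit (j + 1) ∈ E.zdArcA → a + cornerUnit (j + 2) ∈ E.zdArcA →
    ∀ (ω : BondConfig (Site 2)) (t : ℕ), t < exitTime hE ω →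
      cornerOrbit (E.bcBondConfig ω) (startCorner hE) t = (a, j) →
      Complex.exp (-(Real.pi / 6 * turnCount (E.bcBondConfig ω) (startCorner hE) t : ℝ) * I) * I ^ (j : ℕ) *
        Complex.exp (((Real.pi / 6 : ℝ)) * I) = d)

include he hδ hα hΩ hEδ hgood hX hn hn' hYl hYr hArcW in
/-- Sites of the two boundary layers of the window lie on the wired arc. -/
theorem mem_zdArcA_of_chart {x : Site 2} (hA : n - 1 ≤ layerFn j x) (hA' : layerFn j x ≤ n)
    (h1 : Yl ≤ ((meshPoint δ x - c) * e).im) (h2 : ((meshPoint δ x - c) * e).im ≤ Yr) : x ∈ E.zdArcA := by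
  obtain ⟨hY', hX'⟩ := bulk_of_chart hδ hα hX hn' hYl hYr (by omega) h1 h2
  have hin := mem_carrier_of_chart he hδ hα hΩ hX hn hn' hYl hYr (by omega) hA' h1 h2
  have hb := (mem_zdBoundary_iff_layerFn' he hδ hΩ hEδ hgood hX hn hn' hY' hX' hin).2 hA
  exact (hArcW x (by omega) hA' h1 h2).2 hb

include he hδ hα hΩ hEδ hgood hX hY hn hn' hYl hYr hArcW in
/-- **The tip site `a = x − u_j` of a chain site of a wired side satisfies the lattice hypotheses of the wired chain
sum** (`exactPair_wiredChainSum_of_phase`), and `a + u_{j+1} ∈ A` as well. -/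
theorem tipRow_of_chart {x : Site 2} (hA : layerFn j x = n - 2) (h1 : Yl + 3 * δ ≤ ((meshPoint δ x - c) * e).im)
    (h2 : ((meshPoint δ x - c) * e).im ≤ Yr - 3 * δ) :
    (x - cornerUnit j ∈ E.zdArcA ∧ x - cornerUnit j + cornerUnit j ∉ E.zdArcA ∧ x - cornerUnit j + cornerUnit j ∉ E.zdArcB ∧
      x - cornerUnit j + cornerUnit (j + 3) ∉ E.zdArcA ∧ x - cornerUnit j + cornerUnit (j + 3) ∉ E.zdArcB ∧
      x - cornerUnit j + cornerUnit (j + 2) ∈ E.zdArcA ∧ x - cornerUnit j + cornerUnit (j + 2) + cornerUnit (j + 3) ∈ E.zdArcA ∧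
      E.IsInnerFace (faceAt (x - cornerUnit j) j) ∧ E.IsInnerFace (faceAt (x - cornerUnit j) (j + 2)) ∧
      E.IsInnerFace (faceAt (x - cornerUnit j) (j + 3))) ∧ x - cornerUnit j + cornerUnit (j + 1) ∈ E.zdArcA := by
  have hh : Real.sqrt 2 / 2 * δ ≤ δ := by
    have hs2 : Real.sqrt 2 < 1.415 := by rw [Real.sqrt_lt' (by norm_num)]; norm_num
    nlinarith
  have hhp : 0 ≤ Real.sqrt 2 / 2 * δ := by positivity
  set a := x - cornerUnit j with ha
  -- chart of `a` and its neighbours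
  have hAu0 := layerFn_cornerUnit j 0
  have hBu0 := layerFn_succ_cornerUnit j 0
  simp only [add_zero, Matrix.cons_val_zero] at hAu0 hBu0
  have hAa : layerFn j a = n - 1 := by rw [ha, layerFn_sub, hAu0]; omega
  have hYa : ((meshPoint δ a - c) * e).im = ((meshPoint δ x - c) * e).im + Real.sqrt 2 / 2 * δ := by
    rw [hY, hY, ha, layerFn_sub, hBu0]; push_cast; ring
  have hA1 : layerFn j (a + cornerUnit (j + 1)) = n := by rw [layerFn_add_cornerUnit]; simp; omega
  have hA2 : layerFn j (a + cornerUnit (j + 2)) = n := by rw [layerFn_add_cornerUnit]; simp; omega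
  have hA3 : layerFn j (a + cornerUnit (j + 3)) = n - 2 := by rw [layerFn_add_cornerUnit]; simp; omega
  have hA23 : layerFn j (a + cornerUnit (j + 2) + cornerUnit (j + 3)) = n - 1 := by
    rw [layerFn_add_cornerUnit, layerFn_add_cornerUnit]; simp; omega
  obtain ⟨hY1, hY2, hY3, -⟩ := im_tilt_neighbours hY a
  obtain ⟨-, -, hY23, -⟩ := im_tilt_neighbours hY (a + cornerUnit (j + 2))
  have hax : a + cornerUnit j = x := by rw [ha, sub_add_cancel]
  refine ⟨⟨?_, ?_, ?_, ?_, ?_, ?_, ?_, ?_, ?_, ?_⟩, ?_⟩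
  · exact mem_zdArcA_of_chart he hδ hα hΩ hEδ hgood hX hn hn' hYl hYr hArcW (by omega) (by omega) (by linarith) (by linarith)
  · rw [hax]; exact (not_mem_arcs_of_chart he hδ hα hΩ hEδ hgood hX hn hn' hYl hYr (by omega) (by omega) (by linarith)
      (by linarith)).2.1
  · rw [hax]; exact (not_mem_arcs_of_chart he hδ hα hΩ hEδ hgood hX hn hn' hYl hYr (by omega) (by omega) (by linarith)
      (by linarith)).2.2
  · exact (not_mem_arcs_of_chart he hδ hα hΩ hEδ hgood hX hn hn' hYl hYr (by omega) (by omega) (by rw [hY3]; linarith)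
      (by rw [hY3]; linarith)).2.1
  · exact (not_mem_arcs_of_chart he hδ hα hΩ hEδ hgood hX hn hn' hYl hYr (by omega) (by omega) (by rw [hY3]; linarith)
      (by rw [hY3]; linarith)).2.2
  · exact mem_zdArcA_of_chart he hδ hα hΩ hEδ hgood hX hn hn' hYl hYr hArcW (by omega) (by omega) (by rw [hY2]; linarith)
      (by rw [hY2]; linarith)
  · exact mem_zdArcA_of_chart he hδ hα hΩ hEδ hgood hX hn hn' hYl hYr hArcW (by omega) (by omega)
      (by rw [hY23, hY2]; linarith) (by rw [hY23, hY2]; linarith)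
  · have := isInnerFace_of_chart he hδ hα hΩ hEδ hgood hX hn hn' hYl hYr (x := a) (by omega) (by linarith) (by linarith) 0
      (by simp [faceRise]; omega)
    simpa using this
  · exact isInnerFace_of_chart he hδ hα hΩ hEδ hgood hX hn hn' hYl hYr (x := a) (by omega) (by linarith) (by linarith) 2
      (by simp [faceRise]; omega)
  · exact isInnerFace_of_chart he hδ hα hΩ hEδ hgood hX hn hn' hYl hYr (x := a) (by omega) (by linarith) (by linarith) 3
      (by simp [faceRise]; omega)
  · exact mem_zdArcA_of_chart he hδ hα hΩ hEδ hgood hX hn hn' hYl hYr hArcW (by omega) (by omega) (by rw [hY1]; linarith)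
      (by rw [hY1]; linarith)

include he hδ hα hΩ hEδ hgood hX hY hn hn' hYl hYr hArcW hPhW in
/-- **The passage phase at the first dart of a tip cell of a wired side is the constant `d · conj(iʲ e^{iπ/6})`.** -/
theorem wired_phase_of_chart {x : Site 2} (hA : layerFn j x = n - 2) (h1 : Yl + 3 * δ ≤ ((meshPoint δ x - c) * e).im)
    (h2 : ((meshPoint δ x - c) * e).im ≤ Yr - 3 * δ) (ω : BondConfig (Site 2)) (t : ℕ) (ht : t < exitTime hE ω)
    (horb : cornerOrbit (E.bcBondConfig ω) (startCorner hE) t = (x - cornerUnit j, j)) :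
    Complex.exp (-(Real.pi / 6 * turnCount (E.bcBondConfig ω) (startCorner hE) t : ℝ) * I) =
      d * (starRingEnd ℂ) (I ^ (j : ℕ) * Complex.exp ((Real.pi / 6 : ℝ) * I)) := by
  have hh : Real.sqrt 2 / 2 * δ ≤ δ := by
    have hs2 : Real.sqrt 2 < 1.415 := by rw [Real.sqrt_lt' (by norm_num)]; norm_num
    nlinarith
  obtain ⟨⟨haA, -, -, -, -, ha2, -, hf0, -, -⟩, ha1⟩ :=
    tipRow_of_chart he hδ hα hΩ hEδ hgood hX hY hn hn' hYl hYr hArcW hA h1 h2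
  have hAu0 := layerFn_cornerUnit j 0
  have hBu0 := layerFn_succ_cornerUnit j 0
  simp only [add_zero, Matrix.cons_val_zero] at hAu0 hBu0
  have hAa : layerFn j (x - cornerUnit j) = n - 1 := by rw [layerFn_sub, hAu0]; omega
  have hYa : ((meshPoint δ (x - cornerUnit j) - c) * e).im = ((meshPoint δ x - c) * e).im + Real.sqrt 2 / 2 * δ := by
    rw [hY, hY, layerFn_sub, hBu0]; push_cast; ring
  have key := hPhW (x - cornerUnit j) hAa (by rw [hYa]; linarith [hδ]) (by rw [hYa]; linarith) hf0 haA ha1 ha2 ω t ht horb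
  rw [mul_assoc] at key
  exact eq_mul_conj_of_mul_eq (norm_I_pow_mul_exp j _) key

include he hδ hα hΩ hΩD hEδ hE hgood hX hY hn hn' hYl hYr hArcW hd hPhW in
/-- **The chain-layer potential of a wired side runs in the direction `d`.** For an exact pair of `E` at its mesh and a
chain `x_i = x − i(u_j + u_{j+1})` of the window (`A x = n − 2`, `Yl + 3δ ≤ Y(δx)`, `Y(δx_N) ≤ Yr − 3δ`): there is
`R ≥ 0` with `‖Ψ (faceAt x_N j) − Ψ (faceAt x j) − R · d‖ ≤ 5`. -/
theorem wired_chainSum_of_chart' {Φ Ψ : Site 2 → ℂ} (hP : IsExactPair E E.δ Φ Ψ) {x : Site 2}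
    (hA : layerFn j x = n - 2) (h1 : Yl + 3 * δ ≤ ((meshPoint δ x - c) * e).im) (N : ℕ)
    (h2 : ((meshPoint δ (x - (N : ℤ) • (cornerUnit j + cornerUnit (j + 1))) - c) * e).im ≤ Yr - 3 * δ) :
    ∃ R : ℝ, 0 ≤ R ∧ ‖Ψ (faceAt (x - (N : ℤ) • (cornerUnit j + cornerUnit (j + 1))) j) - Ψ (faceAt x j) - (R : ℂ) * d‖ ≤ 5 := by
  set ζ : ℂ := d * (starRingEnd ℂ) (I ^ (j : ℕ) * Complex.exp ((Real.pi / 6 : ℝ) * I)) with hζ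
  set xs : ℕ → Site 2 := fun i => x - (i : ℤ) • (cornerUnit j + cornerUnit (j + 1)) with hxs
  set a : ℕ → Site 2 := fun i => xs i - cornerUnit j with ha
  -- every chain site up to `N` is in the window
  have hwin : ∀ i ≤ N, Yl + 3 * δ ≤ ((meshPoint δ (xs i) - c) * e).im ∧ ((meshPoint δ (xs i) - c) * e).im ≤ Yr - 3 * δ := by
    intro i hi
    rw [hxs]; simp only
    rw [im_tilt_chainSite hY] at h2 ⊢
    have hi' : (i : ℝ) ≤ (N : ℕ) := by exact_mod_cast hi
    have hs : 0 ≤ Real.sqrt 2 * δ := by positivity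
    constructor
    · nlinarith [hs, (Nat.cast_nonneg i : (0 : ℝ) ≤ i)]
    · nlinarith
  -- the wired chain sum along the tip sites `a i`
  have key := exactPair_wiredChainSum_of_phase D E hΩD hE Φ Ψ hP j ζ a N
    (fun m _ => by rw [ha]; simp only; rw [hxs]; simp only; rw [chainSite_succ]; abel)
    (fun m hm => (tipRow_of_chart he hδ hα hΩ hEδ hgood hX hY hn hn' hYl hYr hArcW (x := xs m)
      (by rw [hxs]; simp only; rw [layerFn_chainSite, hA]) (hwin m hm).1 (hwin m hm).2).1)
    (fun m hm ω t ht horb => wired_phase_of_chart he hδ hα hΩ hEδ hE hgood hX hY hn hn' hYl hYr hArcW hPhW (x := xs m)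
      (by rw [hxs]; simp only; rw [layerFn_chainSite, hA]) (hwin m hm).1 (hwin m hm).2 ω t ht horb)
  -- abbreviations for the passage probabilities
  set P : ℕ → ℝ := fun m => (bondPercolation (zdGraph 2) half).real {ω : BondConfig (Site 2) | ∃ k : ℕ,
      (medialExploration E ω)[k]? = some (cornerSource (a m) (faceAt (a m) j)) ∧
      (medialExploration E ω)[k + 1]? = some (cornerTarget (a m) (faceAt (a m) j))} with hP'
  have hP0 : ∀ m, 0 ≤ P m := fun m => measureReal_nonneg
  have hP1 : ∀ m, P m ≤ 1 := fun m => measureReal_le_one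
  have key' : Ψ (faceAt (a N) j) - Ψ (faceAt (a 0) j) =
      I ^ (j : ℕ) * ζ * (∑ m ∈ Finset.range N, (P m : ℂ) + Complex.exp ((Real.pi / 3 : ℝ) * I) * ∑ m ∈ Finset.range N, (P (m + 1) : ℂ)) := by
    rw [key]
  -- the unit algebra: `iʲ ζ = d e^{-iπ/6}`
  set S : ℝ := ∑ m ∈ Finset.range N, P m with hS
  have hS0 : 0 ≤ S := Finset.sum_nonneg fun m _ => hP0 m
  have hSC : (∑ m ∈ Finset.range N, (P m : ℂ)) = (S : ℂ) := by rw [hS]; push_cast; rfl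
  have hshift : (∑ m ∈ Finset.range N, (P (m + 1) : ℂ)) = (S : ℂ) + P N - P 0 := by
    rw [sum_range_shift (fun m => (P m : ℂ)) N, hSC]
  rw [hshift, hSC] at key'
  have hIj : I ^ (j : ℕ) * (starRingEnd ℂ) (I ^ (j : ℕ)) = 1 := by
    rw [mul_conj, normSq_eq_norm_sq, norm_pow, norm_I, one_pow]; norm_num
  have hconj_exp : (starRingEnd ℂ) (Complex.exp ((Real.pi / 6 : ℝ) * I)) = Complex.exp (-(Real.pi / 6 : ℝ) * I) := by
    rw [← Complex.exp_conj, map_mul, Complex.conj_ofReal, Complex.conj_I]; congr 1; push_cast; ring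
  have hIζ : I ^ (j : ℕ) * ζ = d * Complex.exp (-(Real.pi / 6 : ℝ) * I) := by
    rw [hζ, map_mul, hconj_exp]
    calc I ^ (j : ℕ) * (d * ((starRingEnd ℂ) (I ^ (j : ℕ)) * Complex.exp (-(Real.pi / 6 : ℝ) * I)))
        = d * Complex.exp (-(Real.pi / 6 : ℝ) * I) * (I ^ (j : ℕ) * (starRingEnd ℂ) (I ^ (j : ℕ))) := by ring
      _ = d * Complex.exp (-(Real.pi / 6 : ℝ) * I) := by rw [hIj, mul_one]
  have hexp3 : Complex.exp (-(Real.pi / 6 : ℝ) * I) * Complex.exp ((Real.pi / 3 : ℝ) * I) = Complex.exp ((Real.pi / 6 : ℝ) * I) := by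
    rw [← Complex.exp_add]; congr 1; push_cast; ring
  -- the tip chain in the form `√3 S d + d e^{iπ/6} (P N − P 0)`
  have htip : Ψ (faceAt (a N) j) - Ψ (faceAt (a 0) j) - ((Real.sqrt 3 * S : ℝ) : ℂ) * d =
      d * Complex.exp ((Real.pi / 6 : ℝ) * I) * ((P N : ℂ) - P 0) := by
    rw [key', hIζ, Complex.ofReal_mul]
    have h3 := exp_pi_six_add_exp_neg
    linear_combination d * ((S : ℂ) + P N - P 0) * hexp3 + d * (S : ℂ) * h3
  have htip_norm : ‖Ψ (faceAt (a N) j) - Ψ (faceAt (a 0) j) - ((Real.sqrt 3 * S : ℝ) : ℂ) * d‖ ≤ 1 := by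
    rw [htip, norm_mul, norm_mul, hd, norm_exp_ofReal_mul_I, one_mul, one_mul, ← Complex.ofReal_sub, norm_real,
      Real.norm_eq_abs, abs_le]
    constructor <;> linarith [hP0 N, hP1 N, hP0 0, hP1 0]
  -- the two links through the interior corners `x_0 = x` and `x_N`
  have hlink : ∀ m ≤ N, ‖Ψ (faceAt (xs m) j) - Ψ (faceAt (a m) j)‖ ≤ 2 := by
    intro m hm
    have hface : faceAt (a m) j = faceAt (xs m) (j + 1) := by
      rw [ha]; simp only
      have := faceAt_add_unit_succ (xs m - cornerUnit j) j
      rw [sub_add_cancel] at this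
      exact this.symm
    have hAm : layerFn j (xs m) = n - 2 := by rw [hxs]; simp only; rw [layerFn_chainSite, hA]
    obtain ⟨-, hxA, hxB⟩ := not_mem_arcs_of_chart he hδ hα hΩ hEδ hgood hX hn hn' hYl hYr (x := xs m) (by omega) (by omega)
      (by linarith [(hwin m hm).1, hδ]) (by linarith [(hwin m hm).2, hδ])
    have hf0 : E.IsInnerFace (faceAt (xs m) j) := by
      have := isInnerFace_of_chart he hδ hα hΩ hEδ hgood hX hn hn' hYl hYr (x := xs m) (by omega)
        (by linarith [(hwin m hm).1, hδ]) (by linarith [(hwin m hm).2, hδ]) 0 (by simp [faceRise]; omega)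
      simpa using this
    have hf1 : E.IsInnerFace (faceAt (xs m) (j + 1)) :=
      isInnerFace_of_chart he hδ hα hΩ hEδ hgood hX hn hn' hYl hYr (x := xs m) (by omega)
        (by linarith [(hwin m hm).1, hδ]) (by linarith [(hwin m hm).2, hδ]) 1 (by simp [faceRise]; omega)
    rw [hface]
    exact norm_sub_le_two_of_common_corner hE hP hf0 hf1 (isCorner_faceAt _ _) (isCorner_faceAt _ _) hxA hxB
  refine ⟨Real.sqrt 3 * S, by positivity, ?_⟩
  have hx0 : xs 0 = x := by rw [hxs]; simp
  have e1 := hlink N le_rfl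
  have e0 := hlink 0 (Nat.zero_le N)
  rw [hx0] at e0
  have hdecomp : Ψ (faceAt (xs N) j) - Ψ (faceAt x j) - ((Real.sqrt 3 * S : ℝ) : ℂ) * d =
      (Ψ (faceAt (xs N) j) - Ψ (faceAt (a N) j)) + (Ψ (faceAt (a N) j) - Ψ (faceAt (a 0) j) - ((Real.sqrt 3 * S : ℝ) : ℂ) * d) -
        (Ψ (faceAt x j) - Ψ (faceAt (a 0) j)) := by ring
  rw [hdecomp]
  refine (norm_sub_le _ _).trans ?_
  refine (add_le_add (norm_add_le _ _) le_rfl).trans ?_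
  linarith

end Core

/-- **The chain-layer potential of a wired side runs in ONE direction** (registered helper of
`stub_exactPotentialTracePh3`, frame form). For admissible Jordan data `E` (`E.Ω = D.carrier`) on the open tilted
rectangle of a side frame read at its mesh `δ` (`4δ ≤ α`), every lattice point of the rectangle in `Ω_δ`, chart
`(δ/√2)·layerFn j + X₀` / `(δ/√2)·layerFn (j+1) + Y₀`, last inside layer `n`, a window `[Yl, Yr]` with `−β + 3δ < Yl`,
`Yr + 3δ < β` on which (ARC, wired) and (PHASE, wired darts, unit `d`) hold: for every exact pair and chain
`x_i = x − i(u_j + u_{j+1})`, `layerFn j x = n − 2`, `Yl + 3δ ≤ Y(δx)`, `Y(δx_N) ≤ Yr − 3δ`, there is `R ≥ 0` with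
`‖Ψ (faceAt x_N j) − Ψ (faceAt x j) − R·d‖ ≤ 5`. -/
theorem wired_chainSum_of_chart : ∀ (c e : ℂ), ‖e‖ = 1 → ∀ (α β δ : ℝ), 0 < δ → 4 * δ ≤ α → ∀ (D : DobrushinDomain) (E : DiscreteDobrushin), E.Ω = {z : ℂ | |((z - c) * e).re| < α ∧ |((z - c) * e).im| < β} → E.Ω = D.carrier → E.δ = δ → ∀ (hE : E.IsZdAdmissible), (∀ x : Site 2, meshPoint δ x ∈ E.Ω → x ∈ meshDomain E.Ω δ) → ∀ (j : Fin 4) (X₀ Y₀ : ℝ), (∀ x : Site 2, ((meshPoint δ x - c) * e).re = Real.sqrt 2 / 2 * δ * layerFn j x + X₀) → (∀ x : Site 2, ((meshPoint δ x - c) * e).im = Real.sqrt 2 / 2 * δ * layerFn (j + 1) x + Y₀) → ∀ (n : ℤ), Real.sqrt 2 / 2 * δ * n + X₀ < α → α ≤ Real.sqrt 2 / 2 * δ * (n + 1) + X₀ → ∀ (Yl Yr : ℝ), -β + 3 * δ < Yl → Yr + 3 * δ < β → (∀ x : Site 2, n - 4 ≤ layerFn j x → layerFn j x ≤ n → Yl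 ≤ ((meshPoint δ x - c) * e).im → ((meshPoint δ x - c) * e).im ≤ Yr → x ∉ E.zdArcB ∧ (x ∈ E.zdBoundary → x ∈ E.zdArcA)) → ∀ (d : ℂ), ‖d‖ = 1 → (∀ a : Site 2, layerFn j a = n - 1 → Yl ≤ ((meshPoint δ a - c) * e).im → ((meshPoint δ a - c) * e).im ≤ Yr → E.IsInnerFace (faceAt a j) → a ∈ E.zdArcA → a + cornerUnit (j + 1) ∈ E.zdArcA → a + cornerUnit (j + 2) ∈ E.zdArcA → ∀ (ω : BondConfig (Site 2)) (t : ℕ), t < exitTime hE ω → cornerOrbit (E.bcBondConfig ω) (startCorner hE) t = (a, j) → Complex.exp (-(Real.pi / 6 * turnCount (E.bcBondConfig ω) (startCorner hE) t : ℝ) * I) * I ^ (j : ℕ) * Complex.exp (((Real.pi / 6 : ℝ)) * I) = d) → ∀ (Φ Ψ : Site 2 → ℂ), IsExactPair E E.δ Φ Ψ → ∀ (x : Site 2), layerFn j x = n - 2 → Yl + 3 * δ ≤ ((meshPoint δ x - c) * e).im → ∀ (N : ℕ), ((meshPoint δ (x - (N : ℤ) • (cornerUnit j + cornerUnit (j +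 1))) - c) * e).im ≤ Yr - 3 * δ → ∃ R : ℝ, 0 ≤ R ∧ ‖Ψ (faceAt (x - (N : ℤ) • (cornerUnit j + cornerUnit (j + 1))) j) - Ψ (faceAt x j) - (R : ℂ) * d‖ ≤ 5 := by
  intro c e he α β δ hδ hα D E hΩ hΩD hEδ hE hgood j X₀ Y₀ hX hY n hn hn' Yl Yr hYl hYr hArcW d hd hPhW Φ Ψ hP x hA h1 N h2
  exact wired_chainSum_of_chart' he hδ hα hΩ hΩD hEδ hE hgood hX hY hn hn' hYl hYr hArcW hd hPhW hP hA h1 N h2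

end Summit.CriticalPhenomena.CardyFormulaZ2.Cruxes.ParafermionToSLESixFamilies.PotentialDarbouxPicardDiamond

end
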